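import Mathlib

/-!
# Stub `stub_blockTransport` (line `Sketch`, crux `ElementaryWordLength.WordPerSuperQuartic`)

A shifted block of variables `S_{k,c} = {(r, r + k) : c·b ≤ r < (c+1)·b}` of the `n × n`
variable matrix (rows `c·b, …, (c+1)·b - 1`, columns shifted by `k` modulo `n`) is moved onto the
principal diagonal block `D_b = {(i, i) : i < b}` by a row permutation `ρ` and a column
permutation `γ` of `Fin n`:  `(ρ r, γ s) ∈ D_b ↔ (r, s) ∈ S_{k,c}`.

The witnesses are translations of the additive group `Fin n` (`n ≥ 1`; `Fin 0` is empty):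
`ρ r = r - c·b` and `γ s = s - (k + c·b)`.  Then `ρ r = γ s ↔ s = r + k` by the group laws, and
`↑(r - c·b) < b ↔ c·b ≤ ↑r < c·b + b` because `c·b + b ≤ n` rules out wrap-around.
-/

set_option linter.dupNamespace false

namespace Summit.ValiantsHypothesis.ValiantsHypothesis.Theorems.WordPerSuperQuartic

/-- No wrap-around: if `↑d + b ≤ n` then, for `r d : Fin n`, the value of `r - d` (subtraction
modulo `n`) is `< b` exactly when `↑d ≤ ↑r < ↑d + b`. -/
private theorem val_sub_lt_iff {n : ℕ} (r d : Fin n) (b : ℕ) (hdb : (d : ℕ) + b ≤ n) :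
    ((r - d : Fin n) : ℕ) < b ↔ (d : ℕ) ≤ (r : ℕ) ∧ (r : ℕ) < (d : ℕ) + b := by
  rcases le_or_gt d r with h | h
  · rw [Fin.sub_val_of_le h]
    have h' : (d : ℕ) ≤ r := h
    omega
  · rw [Fin.coe_sub_iff_lt.2 h]
    have h' : (r : ℕ) < d := h
    omega

/-- In the additive group `Fin n` (`NeZero n`): `r - d = s - (k + d) ↔ s = r + k`. -/
private theorem sub_eq_sub_add_iff {n : ℕ} [NeZero n] (r s d k : Fin n) :
    r - d = s - (k + d) ↔ s = r + k := by
  rw [← sub_sub, sub_left_inj, eq_sub_iff_add_eq, eq_comm]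

/-- S4 — **block transport**: for `k : Fin n` and `(c + 1) * b ≤ n` there are permutations
`ρ γ` of `Fin n` (translations `ρ r = r - c·b`, `γ s = s - (k + c·b)`) with
`(ρ r = γ s ∧ ↑(ρ r) < b) ↔ (s = r + k ∧ c·b ≤ ↑r < (c+1)·b)`, i.e. `Prod.map ρ γ` carries the
shifted block `S_{k,c}` exactly onto the diagonal block `D_b`. -/
theorem stub_blockTransport (n b c : ℕ) (k : Fin n) (hcb : (c + 1) * b ≤ n) :
    ∃ ρ γ : Equiv.Perm (Fin n), ∀ v : Fin n × Fin n,
      (ρ v.1 = γ v.2 ∧ ((ρ v.1 : Fin n) : ℕ) < b) ↔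
        (v.2 = v.1 + k ∧ c * b ≤ (v.1 : ℕ) ∧ (v.1 : ℕ) < (c + 1) * b) := by
  cases n with
  | zero => exact k.elim0
  | succ m =>
    have hcb' : c * b + b ≤ m + 1 := by rwa [add_one_mul] at hcb
    have hd : c * b < m + 1 := by
      rcases Nat.eq_zero_or_pos b with rfl | hb
      · simp
      · omega
    refine ⟨Equiv.subRight ⟨c * b, hd⟩, Equiv.subRight (k + ⟨c * b, hd⟩), fun v => ?_⟩
    simp only [Equiv.subRight_apply]
    rw [sub_eq_sub_add_iff, val_sub_lt_iff v.1 ⟨c * b, hd⟩ b hcb', add_one_mul]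

end Summit.ValiantsHypothesis.ValiantsHypothesis.Theorems.WordPerSuperQuartic
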